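import Summits.BirchSwinnertonDyer.BirchSwinnertonDyer.Theorems.PrintX10bAnalyticMuZeroX10bStubVasersteinAway
import Summits.BirchSwinnertonDyer.BirchSwinnertonDyer.Theorems.PrintX10bAnalyticMuZeroX10bStubTheoremBOfVasersteinAway
import Summits.BirchSwinnertonDyer.BirchSwinnertonDyer.Theorems.PrintX8VerticalStevensIrreducible
import Summits.BirchSwinnertonDyer.BirchSwinnertonDyer.Theorems.PrintX10bAnalyticMuZeroX10bStubUnitMeasureOfNonconstancy
import Literature.NumberTheory.EllipticCurves.PAdicLFunctionBranchMuCertificateProofs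
import Literature.NumberTheory.EllipticCurves.PAdicLFunctionBranch
import Literature.NumberTheory.EllipticCurves.Rank1Residual.MuLambdaCarriers
import Literature.NumberTheory.EllipticCurves.Rank1Residual.Predicates
import HarnessLib

/-!
# Greenberg's analytic `μ`-conjecture at `p = 3`, ordinary irreducible case — a THEOREM of the tree, class-free:
# for EVERY `E/ℚ` with good ordinary reduction at `3` and `E[3]` irreducible, `μ(L₃(E)) = 0` (`MuAnZeroAt W 3`)

Cell `bsd-f3-mu`, width seat p1-w3 (bsd-f3-mu CANDIDATES row 31 **AN-12 `MuAnZeroAtThreeOrdIrreducible`**, «the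
FAMILY THEOREM at 3», -an g5 MEMO-an §14.4; `--supports stmt-BirchSwinnertonDyer-20682`, helper).

WHY THIS FILE.  Crux stmt-BirchSwinnertonDyer-20682 `PrintX10b.AnalyticMuZeroX10b` was closed `proved`
unconditionally (p576451, LINE `theoremB-x10b`), but its TYPE is the class node `X10.AnalyticMuZeroOnClassX10b`:
`ClassX10 W p → ¬ Surj W 3 → IsNewformOf W f → ∃ n, ‖[Tⁿ] L_3(f, α_W)‖ = 1`, i.e. it carries the analytic-rank /
ramification / semistability clauses of class X10 AND non-surjectivity of `ρ̄_{E,3}` as hypotheses — none of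
which the proof uses (planner-of-record -imc g7, W-51 (U4) booking paragraph 2026-08-27T22:05Z: «WHAT THE PROOF
USES: ONLY p = 3, good ordinary at 3, E[3] irreducible»).  The sentence the cell books and ref2 g12 placed
(«μ(L₃(E₀)) = 0 for every E/ℚ good ordinary at 3 with irreducible E[3]» — NOT IN PRINT at any fixed prime for
residually irreducible `E`: Greenberg LNM 1716 Conj. 1.11 / p. 137; EPW 2006; Greenberg–Vatsal 2000 cover the
residually REDUCIBLE and the transfer cases) is stated here EXACTLY, over the tree carrier
`Rank1Residual.MuAnZeroAt W 3` (`:= ∀ newform f of W, ∃ n, ‖[Tⁿ] L_3(f, unitRoot W 3)‖ = 1`), with NO class, rank,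
image or CM hypothesis and NO named fact:

* `muAnZeroAt_three` — `IsOrdinaryAt W 3 → E[3] irreducible → MuAnZeroAt W 3` (**AN-12, input-free**).
* `exists_norm_coeff_padicLFunction_three_eq_one` — the same unfolded at a newform `f`.
* `muAnZeroAt_of_classX10` / `exists_norm_coeff_eq_one_of_classX10` — on the whole class X10 of the rank-≤ 1
  residual partition (`Rank1Residual.ClassX10 W p`: `p = 3`, `3` good ordinary, `E[3]` irreducible, off the printed
  floor), BOTH image halves: X10a (`ρ̄_{E,3}` surjective — the 508-curve AN-D9 control population) and X10b
  (`ρ̄_{E,3}` not surjective, 883 census classes — the closed crux).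

CHAIN (every arrow a tree theorem): (V) Vaserstein over `ℤ[1/m]` (`SL2Rel.Away.relG_le_relE_span_natCast`, stub 1a
p575575) ⟹ THEOREM B `ConjSpanGenAll` (orbit trick, stub 1b p572175) ⟹ AN-9 `CycWindingNonConstantAt W 3`
(bsd-print-x8 p1 `cycWindingNonConstancyOddIrreducible_of_conjSpanGenAll`) ⟹ a unit value of `μ_{f,α}` at a unit
residue (bsd-f3-mu-an g5 `CollapseThree.exists_isUnit_one_le_norm_msdMeasure_three`, stub 3a file p572034) ⟹ some EVEN
branch `i < 2` with a unit coefficient (bsd-print-x9 p2 `exists_even_branch_norm_coeff_eq_one_of_unit_msdMeasure_of_isNewformOf`,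
p572273) ⟹ `i = 0` and `L_3(f, α, ω⁰) = L_3(f, α)` (`padicLFunctionBranch_zero`).  No `Theses` import.

READING.  `L_3(f, α)` is the Mazur–Swinnerton-Dyer `3`-adic `L`-function of the NEWFORM `f` (period `Ω⁺_f`); for
the curve `E` itself `Ω⁺_f / Ω⁺_E` is a `3`-adic unit when `3 ∤` Manin constant and the isogeny class has no
`3`-isogeny (`E[3]` irreducible) — an input of the READING «Greenberg's `μ_E = 0`», not of this proof (-imc g7
THEOREM-B-AUDIT-MAP §3).  The algebraic `μ` (Greenberg's Conj. 1.11 proper, `GreenbergMuConjectureIrreducible`)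
is NOT touched here.  `p ≥ 5`: the same chain gives only «some even branch» (`PrintX9EvenBranchMuZeroInputFree`),
not `ω⁰`.  BSD is not proved by any of this.  References: [GreenbergLNM1716] Conj. 1.11; [MazurTateTeitelbaum1986Invent]
§I.10, §I.13; [GreenbergVatsal2000] Prop. (3.7); [Vaserstein1972SL2]; [Manin1972] Prop. 1.4.
-/

-- the summit and its single problem are both named `BirchSwinnertonDyer` (registry layout D-0017)
set_option linter.dupNamespace false

open scoped Classical MatrixGroups ModularForm

open CongruenceSubgroup WeierstrassCurve Literature.NumberTheory.EllipticCurves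
  Literature.NumberTheory.EllipticCurves.ModularForms
  Literature.NumberTheory.EllipticCurves.Rank1Residual
  Summit.BirchSwinnertonDyer.BirchSwinnertonDyer.Theorems
  Summit.BirchSwinnertonDyer.BirchSwinnertonDyer.Cruxes.AnalyticMuZeroX10b

namespace Summit.BirchSwinnertonDyer.BirchSwinnertonDyer.Rank1Residual.AnalyticMuZeroThree

/-- **Greenberg's analytic `μ = 0` at `p = 3`, ordinary irreducible case — THEOREM, input-free** (bsd-f3-mu AN-12
`MuAnZeroAtThreeOrdIrreducible`): for every elliptic curve `E/ℚ` with globally minimal model `W`, GOOD ORDINARY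
reduction at `3` and `E[3]` an IRREDUCIBLE `G_ℚ`-module, and every newform `f` attached to `E`, the
Mazur–Swinnerton-Dyer `3`-adic `L`-function `L_3(f, α_W; T) ∈ ℚ₃⟦T⟧` (`α_W = unitRoot W 3`) has a coefficient of
`3`-adic norm exactly `1`: its analytic `μ`-invariant is `0` (`MuAnZeroAt W 3`).  No class, rank, image or CM
hypothesis; no named fact.  Chain: (V) ⟹ THEOREM B ⟹ AN-9 non-constancy ⟹ unit measure value at a unit residue ⟹
an even branch `i < 2` with a unit coefficient ⟹ `i = 0`, `ω⁰`-branch `=` `L_3(f, α)`.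
[cite: GreenbergLNM1716, §1 Conj. 1.11 (p. 58)] [cite: MazurTateTeitelbaum1986Invent, §I.10 (10.1)–(10.2) and §I.13]
[cite: GreenbergVatsal2000, §3 Prop. (3.7)] [cite: Vaserstein1972SL2, Theorem (p. 313)] [cite: Manin1972, Prop. 1.4] -/
theorem muAnZeroAt_three (W : WeierstrassCurve ℚ) [W.IsElliptic] [W.IsGloballyMinimal]
    (hord : IsOrdinaryAt W 3) (hirr : W.HasIrreducibleModPGaloisRep 3) : MuAnZeroAt W 3 := by
  intro N _ f hf
  have h32 : (3 : ℕ) ≠ 2 := by decide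
  -- THEOREM B, input-free: stub 1b (orbit trick) applied to stub 1a (Vaserstein over ℤ[1/m], a tree theorem)
  have hB : ∀ (M q : ℕ), q.Prime → ¬ q ∣ M → ConjSpanGen M q :=
    TheoremB.stub_theoremB_of_vasersteinAway TheoremB.stub_vasersteinAway
  -- AN-9: non-constancy of `r ↦ [r]⁺ mod 3` on the 3-power cusps
  have hnc : CycWindingNonConstantAt W 3 :=
    PrintX8VerticalStevens.cycWindingNonConstancyOddIrreducible_of_conjSpanGenAll
      (fun M q _ hq hqM ↦ hB M q hq hqM) W 3 h32 hord.1 hirr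
  -- a unit value of the Mazur–Swinnerton-Dyer measure at a unit residue
  obtain ⟨m, a, hau, ha1⟩ := CollapseThree.exists_isUnit_one_le_norm_msdMeasure_three W f hord hf hirr hnc
  -- some even branch `i < 3 - 1` carries a unit coefficient; `i` even and `< 2` forces `i = 0`
  obtain ⟨i, hi, heven, k, hk⟩ :=
    exists_even_branch_norm_coeff_eq_one_of_unit_msdMeasure_of_isNewformOf h32 hord hf hirr hau ha1
  have hi0 : i = 0 := by
    have h0 : i % 2 = 0 := Nat.even_iff.mp heven
    omega
  subst hi0
  exact ⟨k, by simpa only [padicLFunctionBranch_zero] using hk⟩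

/-- **The same, unfolded at a newform**: `E = W/ℚ` good ordinary at `3`, `E[3]` irreducible, `f` a newform of `E`
⟹ `∃ n, ‖[Tⁿ] L_3(f, unitRoot W 3)‖ = 1`.  Input-free. [cite: GreenbergLNM1716, §1 Conj. 1.11 (p. 58)]
[cite: MazurTateTeitelbaum1986Invent, §I.13] -/
theorem exists_norm_coeff_padicLFunction_three_eq_one (W : WeierstrassCurve ℚ) [W.IsElliptic]
    [W.IsGloballyMinimal] (hord : IsOrdinaryAt W 3) (hirr : W.HasIrreducibleModPGaloisRep 3)
    {N : ℕ} [NeZero N] (f : CuspForm (Gamma0 N) 2) (hf : IsNewformOf W f) :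
    ∃ n : ℕ, ‖PowerSeries.coeff n (padicLFunction f (unitRoot W 3 : ℚ_[3]))‖ = 1 :=
  muAnZeroAt_three W hord hirr f hf

/-- **On the whole class X10 of the rank-`≤ 1` residual partition** (`Rank1Residual.ClassX10 W p`: `p = 3`, good
ordinary at `3`, `E[3]` irreducible, `(r_an = 0 ∧ ¬ram(3)) ∨ (r_an = 1 ∧ ¬sst)`), BOTH image halves — X10a
(`ρ̄_{E,3}` surjective) and X10b (`ρ̄_{E,3}` not surjective, the closed crux 20682): `MuAnZeroAt W p`.  Only the
fields `GoodOrd W 3` and `Irr W 3` of the class are used. [cite: GreenbergLNM1716, §1 Conj. 1.11 (p. 58)] -/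
theorem muAnZeroAt_of_classX10 (W : WeierstrassCurve ℚ) [W.IsElliptic] [W.IsGloballyMinimal] (p : ℕ)
    [Fact p.Prime] (hX : ClassX10 W p) : MuAnZeroAt W p := by
  obtain ⟨rfl, hgo, hirr, -⟩ := hX
  exact muAnZeroAt_three W ((isOrdinaryAt_iff W 3).mpr hgo) hirr

/-- **Class X10, unfolded**: for every X10 pair `(W, p)` (so `p = 3`), surjective mod-3 image OR NOT, and every
newform `f` of `W`, some coefficient of `L_3(f, α_W)` is a `3`-adic unit.  Compare the crux node
`X10.AnalyticMuZeroOnClassX10b` (closed by p576451), which additionally displays `¬ Surj W 3`.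
[cite: GreenbergLNM1716, §1 Conj. 1.11 (p. 58)] -/
theorem exists_norm_coeff_eq_one_of_classX10 :
    ∀ (W : WeierstrassCurve ℚ) [W.IsElliptic] [W.IsGloballyMinimal] (p : ℕ) [Fact p.Prime]
      {N : ℕ} [NeZero N] (f : CuspForm (Gamma0 N) 2), ClassX10 W p → IsNewformOf W f →
        ∃ n : ℕ, ‖PowerSeries.coeff n (padicLFunction f (unitRoot W p : ℚ_[p]))‖ = 1 :=
  fun W _ _ p _ _ _ f hX hf ↦ muAnZeroAt_of_classX10 W p hX f hf

end Summit.BirchSwinnertonDyer.BirchSwinnertonDyer.Rank1Residual.AnalyticMuZeroThree
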